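import Mathlib
import HarnessLib
import Summits.CriticalPhenomena.CardyFormulaZ2.Theorems.CardyMagicRigidityMagicFormulaTCentring
import Summits.CriticalPhenomena.CardyFormulaZ2.Theorems.CardyMagicRigidityMagicFormulaTHexCells
import Summits.CriticalPhenomena.CardyFormulaZ2.Theorems.CardyMagicRigidityMagicFormulaTStubCellBridge
import Summits.CriticalPhenomena.CardyFormulaZ2.Theorems.CardyMagicRigidityMagicFormulaTStubDilation
import Summits.CriticalPhenomena.CardyFormulaZ2.Theorems.CardyMagicRigidityTransferContinuityReduction
import Literature.Probability.RandomPlanarGeometry.NestingTransform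

/-!
# Smeared exact centring of the twisted nesting phases on `δ𝕋` (crux `MagicFormulaT`, line `Sketch`)

Crux `Summit.CriticalPhenomena.CardyFormulaZ2.Theses.CardyMagicRigidity.MagicFormulaT`
(stmt-CriticalPhenomena-4836), line `Sketch` — the exact centring identity of
`CardyMagicRigidityMagicFormulaTCentring` (charges at sites) transported to the crux's own smeared
phases `θ_u = ∫_{W(u,·) ≠ 0} f` by the Voronoi-cell bridge and the dilation identity of the line:

**Theorem (`integral_finsum_nestingPhase_eq_zero`, sub-goal `smearedCentring`).** For every
Bernoulli parameter `p`, every admissible neutral density `f` (measurable, `|f| ≤ C`, `f = 0` off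
`‖z‖ ≤ R`, `∫ f = 0`) and every mesh `δ > 0`,
`E_p[ Σ_{u interface loop of δ𝕋} ∫_{W(u,·) ≠ 0} f ] = 0`.
So the twisted nesting transform `t ↦ Λ^𝕋_δ(t f)` of the crux has NO linear term at ANY mesh; the
same holds on the unit lattice for the dilated density `δ² f(δ·)` restricted to any family of
loops invariant under the point reflections through half-lattice points, in particular for the
big loops (`bigLoops η`, the truncated transform) and for the small loops (`diam < η`, the loops
dropped by the truncation: the linear part of the small-loop centring hypothesis (T) of
`CardyMagicRigidityTransferContinuityReduction` is an identity, in large-scale form).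

Proof: loop by loop, `∫_{W(u,·)≠0} δ² f(δ·) = Σ_x 𝟙[W(u, x) ≠ 0] λ_x` with the cell charges
`λ_x = ∫_{H_x} δ² f(δ·)` (`nestingPhase_dilate_eq_sum`: winding numbers of interface loops are
constant on the open Voronoi hexagons, which tile `ℂ` up to a null set and carry the density —
the ingredients of `stub_cellBridge`), the cell charges are neutral (`sum_cellCharge_eq_zero`), so
the dense centring identity applies; at mesh `δ` the loops are the dilates of the unit-lattice
loops and `∫_{δA} f = ∫_A δ² f(δ·)` (`finsum_nestingPhase_eq_finsum_dilate`, the `finsum`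
counterpart of `stub_dilation`).

No definition is introduced (`𝓗[x]` is a local notation); everything is proved from tree /
Mathlib material; no named fact is used.
-/

noncomputable section

namespace Summit.CriticalPhenomena.CardyFormulaZ2.Cruxes.MagicFormulaT.LineSketch

open MeasureTheory Set
open Literature.Probability.Percolation Literature.Probability.LatticeModels

section SmearedCentring

open Literature.Probability.RandomPlanarGeometry Metric Finset
open scoped unitInterval

/-- The open Voronoi hexagon of the site `x` of the unit lattice (local notation, as in
`StubCellBridge`). -/
local notation3 (prettyPrint := false) "𝓗[" x "]" =>
  {z : ℂ | ∀ i : Fin 3, |hform i (z - triMeshPoint 1 x)| < 1}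

/-! ## The smeared phase of a loop is a neutral combination of cell charges -/

section Density

variable {f : ℂ → ℝ} {R C δ : ℝ}

/-- **Cell decomposition of the smeared phase** (the loop-by-loop content of `stub_cellBridge`):
for a loop `u` of the unit-lattice configuration, the phase of the dilated density
`g = δ² f(δ ·)` is the combination of the cell charges `λ_x = ∫_{H_x} g` of the cells it winds
around, `∫_{W(u,·) ≠ 0} g = Σ_x 𝟙[W(u, x) ≠ 0] λ_x`. -/
theorem nestingPhase_dilate_eq_sum (hf : Measurable f) (hC : ∀ z, |f z| ≤ C)
    (hR : ∀ z, R < ‖z‖ → f z = 0) (hδ : 0 < δ) {ω : SiteConfig (Site 2)} {u : UnbasedLoop ℂ}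
    (hu : u ∈ (siteLoopConfig 1 ω).loops) :
    ∫ z in {z : ℂ | u.wind z ≠ 0}, δ ^ 2 * f ((δ : ℂ) * z) =
      ∑ x ∈ triBall ⌈2 * (R / δ + 1)⌉₊, if u.wind (triMeshPoint 1 x) ≠ 0 then
        ∫ z in 𝓗[x], δ ^ 2 * f ((δ : ℂ) * z) else 0 := by
  have hg := integrable_dilate hf hC hR hδ
  have hcover := ae_dilate_eq_zero_off_cells (f := f) hR hδ
  have hHm : ∀ x ∈ triBall ⌈2 * (R / δ + 1)⌉₊, MeasurableSet 𝓗[x] := fun x _ ↦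
    measurableSet_hexCell x
  have hdisj : ((triBall ⌈2 * (R / δ + 1)⌉₊ : Finset (Site 2)) : Set (Site 2)).PairwiseDisjoint
      (fun x : Site 2 ↦ 𝓗[x]) := fun x _ y _ hxy ↦ disjoint_hexCell hxy
  rw [Summit.CriticalPhenomena.CardyFormulaZ2.Theorems.loops_siteLoopConfig] at hu
  obtain ⟨v, γ, hγ, rfl⟩ := hu
  exact setIntegral_setOf_ne_zero_eq_sum (triBall ⌈2 * (R / δ + 1)⌉₊) hHm hdisj hg hcover
    (UnbasedLoop.isOpen_setOf_wind_ne_zero _).measurableSet (fun x ↦ triMeshPoint 1 x)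
    (fun x _ z hz ↦ wind_eq_wind_triMeshPoint_of_mem_hexCell hγ x hz)

/-- **The cell charges of a neutral density are neutral**: `Σ_x ∫_{H_x} g = ∫ g = 0`. -/
theorem sum_cellCharge_eq_zero (hf : Measurable f) (hC : ∀ z, |f z| ≤ C)
    (hR : ∀ z, R < ‖z‖ → f z = 0) (h0 : ∫ z, f z = 0) (hδ : 0 < δ) :
    ∑ x ∈ triBall ⌈2 * (R / δ + 1)⌉₊, ∫ z in 𝓗[x], δ ^ 2 * f ((δ : ℂ) * z) = 0 := by
  have hg := integrable_dilate hf hC hR hδ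
  have hcover := ae_dilate_eq_zero_off_cells (f := f) hR hδ
  have hHm : ∀ x ∈ triBall ⌈2 * (R / δ + 1)⌉₊, MeasurableSet 𝓗[x] := fun x _ ↦
    measurableSet_hexCell x
  have hdisj : ((triBall ⌈2 * (R / δ + 1)⌉₊ : Finset (Site 2)) : Set (Site 2)).PairwiseDisjoint
      (fun x : Site 2 ↦ 𝓗[x]) := fun x _ y _ hxy ↦ disjoint_hexCell hxy
  rw [← integral_eq_sum_setIntegral (triBall ⌈2 * (R / δ + 1)⌉₊) hHm hdisj hg hcover]
  exact integral_dilate_eq_zero h0 δ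

/-! ## Smeared centring on the unit lattice (large-scale form) -/

/-- **SMEARED EXACT CENTRING within a reflection-invariant family (unit lattice).** For every
admissible neutral density `f` (measurable, `|f| ≤ C`, `f = 0` off `‖z‖ ≤ R`, `∫ f = 0`), every
`δ > 0`, every Bernoulli parameter and every family `T` of loops invariant under the point
reflections through half-lattice points,
`E_p[Σ_{u interface loop of 𝕋, u ∈ T} ∫_{W(u,·) ≠ 0} δ² f(δ z) dz] = 0`. -/
theorem integral_finsum_nestingPhase_dilate_eq_zero_of_invariant {T : Set (UnbasedLoop ℂ)}
    (hT : ∀ (c : Site 2) (u : UnbasedLoop ℂ),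
      UnbasedLoop.imageOn (fun z ↦ triEmbed c - z) Set.univ u ∈ T ↔ u ∈ T)
    (p : unitInterval) (hf : Measurable f) (hC : ∀ z, |f z| ≤ C)
    (hR : ∀ z, R < ‖z‖ → f z = 0) (h0 : ∫ z, f z = 0) (hδ : 0 < δ) :
    ∫ ω, (∑ᶠ u ∈ (siteLoopConfig 1 ω).loops ∩ T,
        ∫ z in {z : ℂ | u.wind z ≠ 0}, δ ^ 2 * f ((δ : ℂ) * z)) ∂(triSitePercolation p) = 0 := by
  have hcongr : ∀ ω : SiteConfig (Site 2), (∑ᶠ u ∈ (siteLoopConfig 1 ω).loops ∩ T,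
      ∫ z in {z : ℂ | u.wind z ≠ 0}, δ ^ 2 * f ((δ : ℂ) * z)) =
      ∑ᶠ u ∈ (siteLoopConfig 1 ω).loops ∩ T, ∑ x ∈ triBall ⌈2 * (R / δ + 1)⌉₊,
        if u.wind (triMeshPoint 1 x) ≠ 0 then ∫ z in 𝓗[x], δ ^ 2 * f ((δ : ℂ) * z) else 0 :=
    fun ω ↦ finsum_mem_congr rfl fun u hu ↦ nestingPhase_dilate_eq_sum hf hC hR hδ hu.1
  simp_rw [hcongr]
  exact integral_finsum_phase_eq_zero_of_invariant hT p _ _ (sum_cellCharge_eq_zero hf hC hR h0 hδ)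

/-- **SMEARED EXACT CENTRING (unit lattice, all loops).** For every admissible neutral density
`f`, `δ > 0` and Bernoulli parameter `p`,
`E_p[Σ_{u interface loop of 𝕋} ∫_{W(u,·) ≠ 0} δ² f(δ z) dz] = 0` — the linear term of the
large-scale transform `t ↦ Λ^𝕋_1(t f_δ)` of `LargeScaleMagicT` vanishes identically. -/
theorem integral_finsum_nestingPhase_dilate_eq_zero (p : unitInterval) (hf : Measurable f)
    (hC : ∀ z, |f z| ≤ C) (hR : ∀ z, R < ‖z‖ → f z = 0) (h0 : ∫ z, f z = 0) (hδ : 0 < δ) :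
    ∫ ω, (∑ᶠ u ∈ (siteLoopConfig 1 ω).loops,
        ∫ z in {z : ℂ | u.wind z ≠ 0}, δ ^ 2 * f ((δ : ℂ) * z)) ∂(triSitePercolation p) = 0 := by
  have h := integral_finsum_nestingPhase_dilate_eq_zero_of_invariant (T := Set.univ)
    (fun _ _ ↦ by simp only [Set.mem_univ]) p hf hC hR h0 hδ
  simp only [Set.inter_univ] at h
  exact h

/-- **SMEARED EXACT CENTRING over the big loops (unit lattice).** For every admissible neutral
density `f`, `δ > 0`, cut-off `η` and Bernoulli parameter `p`,
`E_p[Σ_{u : diam u ≥ η} ∫_{W(u,·) ≠ 0} δ² f(δ z) dz] = 0`: the truncated transform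
`truncNestingWeight` has no linear term either. -/
theorem integral_finsum_nestingPhase_dilate_bigLoops_eq_zero (η : ℝ) (p : unitInterval)
    (hf : Measurable f) (hC : ∀ z, |f z| ≤ C) (hR : ∀ z, R < ‖z‖ → f z = 0) (h0 : ∫ z, f z = 0)
    (hδ : 0 < δ) :
    ∫ ω, (∑ᶠ u ∈ (siteLoopConfig 1 ω).bigLoops η,
        ∫ z in {z : ℂ | u.wind z ≠ 0}, δ ^ 2 * f ((δ : ℂ) * z)) ∂(triSitePercolation p) = 0 := by
  have hbig : ∀ ω : SiteConfig (Site 2), (siteLoopConfig 1 ω).bigLoops η =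
      (siteLoopConfig 1 ω).loops ∩ {u | η ≤ Metric.diam u.range} := fun ω ↦ by
    ext u; rw [LoopConfig.mem_bigLoops_iff]; rfl
  simp_rw [hbig]
  exact integral_finsum_nestingPhase_dilate_eq_zero_of_invariant
    (fun c u ↦ by simp only [Set.mem_setOf_eq, diam_range_imageOn_reflect]) p hf hC hR h0 hδ

/-- **SMEARED EXACT CENTRING over the small loops (unit lattice)**: the loops dropped by the
truncation carry no linear term — the linear part of hypothesis (T) of
`CardyMagicRigidityTransferContinuityReduction`, in large-scale form. -/
theorem integral_finsum_nestingPhase_dilate_smallLoops_eq_zero (η : ℝ) (p : unitInterval)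
    (hf : Measurable f) (hC : ∀ z, |f z| ≤ C) (hR : ∀ z, R < ‖z‖ → f z = 0) (h0 : ∫ z, f z = 0)
    (hδ : 0 < δ) :
    ∫ ω, (∑ᶠ u ∈ (siteLoopConfig 1 ω).loops ∩ {u | Metric.diam u.range < η},
        ∫ z in {z : ℂ | u.wind z ≠ 0}, δ ^ 2 * f ((δ : ℂ) * z)) ∂(triSitePercolation p) = 0 :=
  integral_finsum_nestingPhase_dilate_eq_zero_of_invariant
    (fun c u ↦ by simp only [Set.mem_setOf_eq, diam_range_imageOn_reflect]) p hf hC hR h0 hδ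

end Density

/-! ## Smeared centring at mesh `δ` -/

/-- **The total smeared phase at mesh `δ` is the total smeared phase of the dilated density on
the unit lattice** (configuration by configuration: the loops of `δ𝕋` are the dilates of the
loops of `𝕋`, interiors dilate, `∫_{δA} f = ∫_A δ² f(δ·)`; the `finsum` counterpart of
`stub_dilation`). -/
theorem finsum_nestingPhase_eq_finsum_dilate (f : ℂ → ℝ) {δ : ℝ} (hδ : 0 < δ)
    (ω : SiteConfig (Site 2)) :
    (∑ᶠ u ∈ (siteLoopConfig δ ω).loops, ∫ z in {z : ℂ | u.wind z ≠ 0}, f z) =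
      ∑ᶠ u ∈ (siteLoopConfig 1 ω).loops,
        ∫ z in {z : ℂ | u.wind z ≠ 0}, δ ^ 2 * f ((δ : ℂ) * z) := by
  rw [Summit.CriticalPhenomena.CardyFormulaZ2.Theorems.loops_siteLoopConfig,
    Summit.CriticalPhenomena.CardyFormulaZ2.Theorems.loops_siteLoopConfig, loopSet_eq_image δ ω,
    finsum_mem_image (imageOn_mul_injective hδ.ne').injOn]
  refine finsum_mem_congr rfl fun u _ ↦ ?_
  rw [setOf_wind_imageOn_mul_ne_zero hδ u, setIntegral_smul_set_eq f hδ]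

/-- **SMEARED EXACT CENTRING at mesh `δ` (all interface loops, every Bernoulli parameter).** For
every admissible neutral density `f` and every `δ > 0`,
`E_p[Σ_{u interface loop of δ𝕋} ∫_{W(u,·) ≠ 0} f] = 0`:
the twisted nesting transform `t ↦ Λ^𝕋_δ(t f)` of the crux has no linear term at any mesh. -/
theorem integral_finsum_nestingPhase_eq_zero (p : unitInterval) {f : ℂ → ℝ} {R C δ : ℝ}
    (hf : Measurable f) (hC : ∀ z, |f z| ≤ C) (hR : ∀ z, R < ‖z‖ → f z = 0) (h0 : ∫ z, f z = 0)
    (hδ : 0 < δ) :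
    ∫ ω, (∑ᶠ u ∈ (siteLoopConfig δ ω).loops, ∫ z in {z : ℂ | u.wind z ≠ 0}, f z)
      ∂(triSitePercolation p) = 0 := by
  simp_rw [finsum_nestingPhase_eq_finsum_dilate f hδ]
  exact integral_finsum_nestingPhase_dilate_eq_zero p hf hC hR h0 hδ

/-- **Sub-goal `smearedCentring` — SMEARED EXACT CENTRING at every mesh (line `Sketch`, crux
`MagicFormulaT`).** For every Bernoulli parameter, every admissible neutral density `f`
(measurable, `|f| ≤ C`, `f = 0` off `‖z‖ ≤ R`, `∫ f = 0`) and every mesh `δ > 0`, the expected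
total phase `E_p[Σ_{u interface loop of δ𝕋} ∫_{W(u,·) ≠ 0} f]` vanishes: the twisted nesting
transform of the crux, `t ↦ Λ^𝕋_δ(t f)`, has no linear term at any mesh. -/
theorem smearedCentring : ∀ (p : unitInterval) (f : ℂ → ℝ) (R C δ : ℝ), Measurable f →
    (∀ z, |f z| ≤ C) → (∀ z, R < ‖z‖ → f z = 0) → ∫ z, f z = 0 → 0 < δ →
      ∫ ω, (∑ᶠ u ∈ (siteLoopConfig δ ω).loops, ∫ z in {z : ℂ | u.wind z ≠ 0}, f z)
        ∂(triSitePercolation p) = 0 :=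
  fun p _ _ _ _ hf hC hR h0 hδ ↦ integral_finsum_nestingPhase_eq_zero p hf hC hR h0 hδ

end SmearedCentring

end Summit.CriticalPhenomena.CardyFormulaZ2.Cruxes.MagicFormulaT.LineSketch

end
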